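import Summits.KontsevichZagierPeriods.KontsevichZagierPeriods.Theorems.LinRedNormalFormArrangementNormalFormStubRebaseSimplePosOneFibreParPiece

/-!
# Stub `stub_rebaseSimplePosOne`, residual hypothesis `Hpar` (crux `ArrangementNormalForm`,
line `janus-bands`, v6.2) — sub-part `ParThin`

**THIN parallel bands, sub-case (B1) over a non-pinching product cell** — the UNFOLD–EXCHANGE
chain assembled on the data of the residual hypothesis `Hpar` of
`RebasePos.good_above_of_residual` (one lettered fibre `t`, letter `0`, affine bounds `0 < u < v`
PARALLEL in `y`: `u_y = v_y = s ≠ 0`, base pole `1/(y − ℓ₂(x'))`), under three explicit extra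
hypotheses:
* `hsec` — the base cell is a PRODUCT `{x'-rows M₀} × (ylo(x'), yhi(x'))`;
* `hη` — its `y`-range is NON-PINCHING (`yhi − ylo ≥ η > 0`);
* `hsign` — (B1): the pole lies on the far side of the `y`-range, BELOW it if `s > 0`
  (`ℓ₂ ≤ ylo`), ABOVE it if `s < 0` (`yhi ≤ ℓ₂`), so that `y` is never between `ℓ₂` and the
  sheared letter `τ = −(t' + u₀)/s` (the naive partial fractions in `y` are NOT dominated there).
The chain (`RebasePos.good_parThin`): shear `t' = t − u(x', y)` (`RebasePos.pull`, rule 2; bounds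
`0 < t' < w(x')`, letter `1/(t' + u)`); cut by the sign of `κ' = u₀ + s ℓ₂` and of `κ' + w`
(`RebasePos.cutBase`) and the `t'`-range at `−κ'` where it changes sign (`RebasePos.cutFibre`),
rule 1a; each piece through `RebasePos.piece_good` (unfold `σ`, cycle, integrate `y` out, split,
two affine pull-backs). The floor inequalities `u(x', ylo) ≥ 0` (`s > 0`) / `u(x', yhi) ≥ 0`
(`s < 0`) are derived from `u > 0` on the open cell. Registered as
`rebaseSimplePos_par_thin_exchange`, target `closure (GGset B 2 1)` (no widening of the target
is needed). NOT covered: (B2) (`y` between `ℓ₂` and `τ`: dominated partial fractions + a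
re-selection of the distinguished coordinate), and PINCHING `y`-ranges, where the final split
diverges (`[{0<y<x<1, y+1<t<y+1+x}, 1/(x²(y+1)t)]`: both `σ`-letters `1/(x² t'σ)`,
`1/(x² t'(σ−x))` have divergent integrals while their difference converges).

References: M. Kontsevich, D. Zagier, *Periods* (2001), §1.2, rules (1a), (1b), (2), (3).
-/

noncomputable section

open Set MeasureTheory MvPolynomial
open Literature.NumberTheory.Transcendental Literature.ModelTheory.ExponentialFields

namespace Summit.KontsevichZagierPeriods.ArrangementNormalForm.JanusBands

namespace RebasePos

open SeparatePos IntegrateOut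

section Thin

variable {B m m' m₀ : ℕ} (L : Fin m → (Fin B → ℚ) × ℚ) (e : Fin m → ℕ) (ℓ₁ ℓ₂ : (Fin B → ℚ) × ℚ)

/-- Shearing along `u`: `pullC 1 u_y u|ₓ' c = c − u`. -/
theorem pullC_one_restr (u c : (Fin (B + 1) → ℚ) × ℚ) : pullC 1 (u.1 (Fin.last B)) (restr B u) c = c - u := by
  refine Prod.ext (funext fun j => ?_) ?_
  · simp only [pullC, div_one, Prod.fst_sub, Pi.sub_apply]
    congr 1
    show Fin.snoc (Fin.init u.1) (u.1 (Fin.last B)) j = u.1 j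
    rw [Fin.snoc_init_self]
  · simp [pullC, restr]

/-- Shearing a form along itself kills it, any scaling: `pullC μ (c_y) (c|ₓ') c = 0`. -/
theorem pullC_self' (μ : ℚ) (c : (Fin (B + 1) → ℚ) × ℚ) : pullC μ (c.1 (Fin.last B)) (restr B c) c = 0 := by
  refine Prod.ext (funext fun j => ?_) ?_
  · simp only [pullC, Prod.fst_zero, Pi.zero_apply]
    rw [div_eq_zero_iff]
    left
    rw [sub_eq_zero]
    show c.1 j = Fin.snoc (Fin.init c.1) (c.1 (Fin.last B)) j
    rw [Fin.snoc_init_self]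
  · simp [pullC, restr]

/-- Shearing along `d` with scaling `μ`: `pullC μ d_y d|ₓ' c = μ⁻¹ • (c − d)`. -/
theorem pullC_restr (μ : ℚ) (d c : (Fin (B + 1) → ℚ) × ℚ) :
    pullC μ (d.1 (Fin.last B)) (restr B d) c = μ⁻¹ • (c - d) := by
  refine Prod.ext (funext fun j => ?_) ?_
  · simp only [pullC, Prod.smul_fst, Prod.fst_sub, Pi.smul_apply, Pi.sub_apply, smul_eq_mul]
    rw [div_eq_inv_mul]
    congr 2
    show Fin.snoc (Fin.init d.1) (d.1 (Fin.last B)) j = d.1 j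
    rw [Fin.snoc_init_self]
  · simp only [pullC, restr, Prod.smul_snd, Prod.snd_sub, smul_eq_mul]
    rw [div_eq_inv_mul]

/-- The coordinate swap `y ↔ t'` fixes the `x'`-slots. -/
theorem swap_yt_x (w : Fin (B + 1 + 1) → ℝ) (i : Fin B) :
    w ((Equiv.swap (Fin.castAdd 1 (Fin.last B)) (Fin.natAdd (B + 1) (0 : Fin 1))) (Fin.castAdd 1 (Fin.castSucc i))) =
      w (Fin.castAdd 1 (Fin.castSucc i)) := by
  rw [Equiv.swap_apply_of_ne_of_ne]
  · intro h
    have := congrArg Fin.val h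
    simp at this
    omega
  · intro h
    have := congrArg Fin.val h
    simp at this
    omega

/-- `x'`-forms are invariant under the coordinate swap `y ↔ t'`. -/
theorem affB_swap_yt (d : (Fin B → ℚ) × ℚ) (w : Fin (B + 1 + 1) → ℝ) :
    affB B 1 d (fun i => w ((Equiv.swap (Fin.castAdd 1 (Fin.last B)) (Fin.natAdd (B + 1) (0 : Fin 1))) i)) = affB B 1 d w := by
  simp only [affB, swap_yt_x]

/-- `x'`-forms do not see the distinguished coordinate. -/
theorem affB_update_y (d : (Fin B → ℚ) × ℚ) (z : Fin (B + 1 + 1) → ℝ) (y : ℝ) :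
    affB B 1 d (Function.update z (Fin.castAdd 1 (Fin.last B)) y) = affB B 1 d z := by
  unfold affB
  congr 1
  refine Finset.sum_congr rfl fun i _ => ?_
  rw [Function.update_of_ne]
  intro h
  have := congrArg Fin.val h
  simp at this
  omega

/-- **The floor inequalities.** If `u = s y + u₀(x') > 0` on the product cell
`{x'-rows} × (ylo, yhi)` (non-degenerate `y`-range), then `u(x', ylo) ≥ 0` if `s > 0` and
`u(x', yhi) ≥ 0` if `s < 0`. -/
theorem floor_of_pos (M : Fin m' → (Fin (B + 1) → ℚ) × ℚ) (M₀ : Fin m₀ → (Fin B → ℚ) × ℚ)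
    (ylo yhi : (Fin B → ℚ) × ℚ) (u : (Fin (B + 1) → ℚ) × ℚ)
    (hcell : ∀ z : Fin (B + 1 + 1) → ℝ, (∀ j, 0 < affF B 1 (M j) z) → 0 < affF B 1 u z)
    (hsec : ∀ z : Fin (B + 1 + 1) → ℝ, (∀ j, 0 < affF B 1 (M j) z) ↔ ((∀ j, 0 < affB B 1 (M₀ j) z) ∧
      affB B 1 ylo z < z (Fin.castAdd 1 (Fin.last B)) ∧ z (Fin.castAdd 1 (Fin.last B)) < affB B 1 yhi z))
    (hne : ∀ z : Fin (B + 1 + 1) → ℝ, (∀ j, 0 < affB B 1 (M₀ j) z) → affB B 1 ylo z < affB B 1 yhi z)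
    (z : Fin (B + 1 + 1) → ℝ) (hz : ∀ j, 0 < affB B 1 (M₀ j) z) :
    (0 < u.1 (Fin.last B) → 0 ≤ (u.1 (Fin.last B) : ℝ) * affB B 1 ylo z + affB B 1 (restr B u) z) ∧
    (u.1 (Fin.last B) < 0 → 0 ≤ (u.1 (Fin.last B) : ℝ) * affB B 1 yhi z + affB B 1 (restr B u) z) := by
  set sR : ℝ := (u.1 (Fin.last B) : ℝ) with hsR
  have hwid := hne z hz
  -- evaluation of `u` at a point of the cell with prescribed `y`
  have hval : ∀ y : ℝ, affB B 1 ylo z < y → y < affB B 1 yhi z →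
      0 < sR * y + affB B 1 (restr B u) z := by
    intro y h1 h2
    set z' := Function.update z (Fin.castAdd 1 (Fin.last B)) y with hz'
    have hrows : ∀ j, 0 < affF B 1 (M j) z' := (hsec z').2 ⟨fun j => by rw [hz', affB_update_y]; exact hz j,
      by rw [hz', affB_update_y, Function.update_self]; exact h1,
      by rw [hz', affB_update_y, Function.update_self]; exact h2⟩
    have h := hcell z' hrows
    rw [affF_split u z', hz', affB_update_y, Function.update_self] at h
    exact h
  constructor
  · intro hs
    have hsp : 0 < sR := by rw [hsR]; exact_mod_cast hs
    by_contra hneg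
    push Not at hneg
    set q : ℝ := sR * affB B 1 ylo z + affB B 1 (restr B u) z with hq
    set δ : ℝ := min ((affB B 1 yhi z - affB B 1 ylo z) / 2) (-q / (2 * sR)) with hδ
    have hδpos : 0 < δ := lt_min (by linarith) (div_pos (by linarith) (by linarith))
    have hδ1 : δ ≤ (affB B 1 yhi z - affB B 1 ylo z) / 2 := min_le_left _ _
    have hδ2 : δ ≤ -q / (2 * sR) := min_le_right _ _
    have h := hval (affB B 1 ylo z + δ) (by linarith) (by linarith)
    have h2 : sR * δ ≤ -q / 2 := by
      have := mul_le_mul_of_nonneg_left hδ2 hsp.le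
      have hq2 : sR * (-q / (2 * sR)) = -q / 2 := by field_simp
      linarith
    have : sR * (affB B 1 ylo z + δ) + affB B 1 (restr B u) z = q + sR * δ := by rw [hq]; ring
    rw [this] at h
    linarith
  · intro hs
    have hsn : sR < 0 := by rw [hsR]; exact_mod_cast hs
    by_contra hneg
    push Not at hneg
    set q : ℝ := sR * affB B 1 yhi z + affB B 1 (restr B u) z with hq
    set δ : ℝ := min ((affB B 1 yhi z - affB B 1 ylo z) / 2) (q / (2 * sR)) with hδ
    have hδpos : 0 < δ := lt_min (by linarith) (div_pos_iff.2 (Or.inr ⟨by linarith, by linarith⟩))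
    have hδ1 : δ ≤ (affB B 1 yhi z - affB B 1 ylo z) / 2 := min_le_left _ _
    have hδ2 : δ ≤ q / (2 * sR) := min_le_right _ _
    have h := hval (affB B 1 yhi z - δ) (by linarith) (by linarith)
    have h2 : -(sR * δ) ≤ -q / 2 := by
      have := mul_le_mul_of_nonpos_left hδ2 hsn.le
      have hs0 : sR ≠ 0 := hsn.ne
      have hq2 : sR * (q / (2 * sR)) = q / 2 := by field_simp
      linarith
    have : sR * (affB B 1 yhi z - δ) + affB B 1 (restr B u) z = q + -(sR * δ) := by rw [hq]; ring
    rw [this] at h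
    linarith

/-- **THIN parallel bands, sub-case (B1), non-pinching product cell.** See the module docstring. -/
theorem good_parThin (s : KZ.IntegralRep (B + 1 + 1)) (M : Fin m' → (Fin (B + 1) → ℚ) × ℚ)
    (M₀ : Fin m₀ → (Fin B → ℚ) × ℚ) (ylo yhi : (Fin B → ℚ) × ℚ) (p : MvPolynomial (Fin B) ℚ)
    (u v : (Fin (B + 1) → ℚ) × ℚ) (hbd : Bornology.IsBounded s.domain)
    (hdom : s.domain = gDom B 1 m' M (fun _ => Sum.inr u) (fun _ => Sum.inr v))
    (hint : EqOn s.integrand (glit B 1 p L e ℓ₁ ℓ₂ 0 1 (fun _ => some 0)) s.domain)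
    (hu : u.1 (Fin.last B) ≠ 0) (hpar : u.1 (Fin.last B) = v.1 (Fin.last B))
    (hcell : ∀ z : Fin (B + 1 + 1) → ℝ, (∀ j, 0 < affF B 1 (M j) z) → 0 < affF B 1 u z ∧ affF B 1 u z < affF B 1 v z)
    (hsec : ∀ z : Fin (B + 1 + 1) → ℝ, (∀ j, 0 < affF B 1 (M j) z) ↔ ((∀ j, 0 < affB B 1 (M₀ j) z) ∧
      affB B 1 ylo z < z (Fin.castAdd 1 (Fin.last B)) ∧ z (Fin.castAdd 1 (Fin.last B)) < affB B 1 yhi z))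
    (hη : ∃ η : ℝ, 0 < η ∧ ∀ z : Fin (B + 1 + 1) → ℝ, (∀ j, 0 < affB B 1 (M₀ j) z) →
      η ≤ affB B 1 yhi z - affB B 1 ylo z)
    (hsign : ∀ z : Fin (B + 1 + 1) → ℝ, (∀ j, 0 < affB B 1 (M₀ j) z) →
      (0 < u.1 (Fin.last B) → affB B 1 ℓ₂ z ≤ affB B 1 ylo z) ∧ (u.1 (Fin.last B) < 0 → affB B 1 yhi z ≤ affB B 1 ℓ₂ z)) :
    ∃ c ∈ AddSubgroup.closure (GGset B 2 1), KZ.of s - c ∈ KZ.relations := by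
  obtain ⟨η, hη0, hη'⟩ := hη
  have hne : ∀ z : Fin (B + 1 + 1) → ℝ, (∀ j, 0 < affB B 1 (M₀ j) z) → affB B 1 ylo z < affB B 1 yhi z :=
    fun z hz => by have := hη' z hz; linarith
  have hfloor : ∀ z : Fin (B + 1 + 1) → ℝ, (∀ j, 0 < affB B 1 (M₀ j) z) →
      (0 < u.1 (Fin.last B) → affB B 1 ℓ₂ z ≤ affB B 1 ylo z ∧
        0 ≤ (u.1 (Fin.last B) : ℝ) * affB B 1 ylo z + affB B 1 (restr B u) z) ∧
      (u.1 (Fin.last B) < 0 → affB B 1 yhi z ≤ affB B 1 ℓ₂ z ∧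
        0 ≤ (u.1 (Fin.last B) : ℝ) * affB B 1 yhi z + affB B 1 (restr B u) z) := by
    intro z hz
    have hf := floor_of_pos M M₀ ylo yhi u (fun z hz => (hcell z hz).1) hsec hne z hz
    exact ⟨fun h => ⟨(hsign z hz).1 h, hf.1 h⟩, fun h => ⟨(hsign z hz).2 h, hf.2 h⟩⟩
  -- (1) shear `t' = t − u(x', y)`
  obtain ⟨s₁, -, hbd₁, hdom₁, hint₁, hrel₁⟩ := pull (fun _ : Fin 1 => (1 : ℚ)) (fun _ => u.1 (Fin.last B))
    (fun _ => restr B u) s M L e p ℓ₁ ℓ₂ 0 1 (fun _ => some 0) (fun _ => Sum.inr u) (fun _ => Sum.inr v) hbd hdom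
    hint (fun _ => one_ne_zero) (fun i j hij => by rcases hij with h | h <;> cases h)
  set wd : (Fin (B + 1) → ℚ) × ℚ := v - u with hwd
  have hwd0 : wd.1 (Fin.last B) = 0 := by rw [hwd]; simp [hpar]
  have h01 : (0 : ℚ) < 1 := one_pos
  have hlo₁ : pullLo (fun _ : Fin 1 => (1 : ℚ)) (fun _ => u.1 (Fin.last B)) (fun _ => restr B u)
      (fun _ => Sum.inr u) (fun _ => Sum.inr v) = fun _ => Sum.inr 0 := by
    funext i; simp [pullLo, h01, pullC_one_restr]
  have hhi₁ : pullHi (fun _ : Fin 1 => (1 : ℚ)) (fun _ => u.1 (Fin.last B)) (fun _ => restr B u)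
      (fun _ => Sum.inr u) (fun _ => Sum.inr v) = fun _ => Sum.inr wd := by
    funext i; simp [pullHi, h01, pullC_one_restr, hwd]
  have ha₁ : pullA (fun _ : Fin 1 => (1 : ℚ)) (fun _ => u.1 (Fin.last B)) (fun _ => restr B u)
      (fun _ => some (0 : (Fin (B + 1) → ℚ) × ℚ)) = fun _ => some (-u) := by
    funext i; simp [pullA, pullC_one_restr]
  rw [hlo₁, hhi₁] at hdom₁
  rw [ha₁] at hint₁
  set p₃ := MvPolynomial.C (pullQ (fun _ : Fin 1 => (1 : ℚ)) (fun _ => some (0 : (Fin (B + 1) → ℚ) × ℚ))) * p with hp₃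
  suffices hs₁ : ∃ c ∈ AddSubgroup.closure (GGset B 2 1), KZ.of s₁ - c ∈ KZ.relations by
    obtain ⟨c₀, hc₀, hc₀'⟩ := hs₁
    exact ⟨c₀, hc₀, by have := add_mem hrel₁ hc₀'; rwa [sub_add_sub_cancel] at this⟩
  -- (2) the pieces
  set sR : ℝ := (u.1 (Fin.last B) : ℝ) with hsR
  set κx : (Fin B → ℚ) × ℚ := restr B u - (-u.1 (Fin.last B)) • ℓ₂ with hκx
  set κF : (Fin (B + 1) → ℚ) × ℚ := ((Fin.snoc κx.1 0 : Fin (B + 1) → ℚ), κx.2) with hκF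
  have hκv : ∀ z : Fin (B + 1 + 1) → ℝ, affF B 1 κF z = affB B 1 (restr B u) z + sR * affB B 1 ℓ₂ z := fun z => by
    rw [hκF, affF_liftB, hκx, affB_sub, affB_smul', hsR]; push_cast; ring
  have hκF0 : κF.1 (Fin.last B) = 0 := by rw [hκF]; simp
  have hwdF0 : (κF + wd).1 (Fin.last B) = 0 := by simp [hκF0, hwd0]
  have hneg0 : ∀ c : (Fin (B + 1) → ℚ) × ℚ, c.1 (Fin.last B) = 0 → (-c).1 (Fin.last B) = 0 := fun c hc => by
    simp [hc]
  have haddv : ∀ z : Fin (B + 1 + 1) → ℝ, affF B 1 (κF + wd) z = affF B 1 κF z + affF B 1 wd z := fun z => by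
    have := affF_sub'' (κF + wd) wd z; rw [add_sub_cancel_right] at this; linarith
  -- the key piece lemma
  have key : ∀ (k : ℕ) (sP : KZ.IntegralRep (B + 1 + 1)) (Mc : Fin k → (Fin (B + 1) → ℚ) × ℚ)
      (tloF thiF : (Fin (B + 1) → ℚ) × ℚ), (∀ j, (Mc j).1 (Fin.last B) = 0) → tloF.1 (Fin.last B) = 0 →
      thiF.1 (Fin.last B) = 0 →
      (∀ z, z ∈ sP.domain ↔ ((∀ j, 0 < affF B 1 (M j) z) ∧ ∀ j, 0 < affF B 1 (Mc j) z) ∧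
        affF B 1 tloF z < z (Fin.natAdd (B + 1) 0) ∧ z (Fin.natAdd (B + 1) 0) < affF B 1 thiF z) →
      sP.domain ⊆ s₁.domain → sP.integrand = s₁.integrand →
      (∀ z : Fin (B + 1 + 1) → ℝ, (∀ j, 0 < affF B 1 (Mc j) z) → 0 ≤ affF B 1 tloF z) →
      ((∀ (z : Fin (B + 1 + 1) → ℝ) (t : ℝ), (∀ j, 0 < affF B 1 (Mc j) z) → affF B 1 tloF z < t →
          t < affF B 1 thiF z → 0 < t + (affB B 1 (restr B u) z + (u.1 (Fin.last B) : ℝ) * affB B 1 ℓ₂ z)) ∨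
        (∀ (z : Fin (B + 1 + 1) → ℝ) (t : ℝ), (∀ j, 0 < affF B 1 (Mc j) z) → affF B 1 tloF z < t →
          t < affF B 1 thiF z → t + (affB B 1 (restr B u) z + (u.1 (Fin.last B) : ℝ) * affB B 1 ℓ₂ z) < 0)) →
      ∃ c ∈ AddSubgroup.closure (GGset B 2 1), KZ.of sP - c ∈ KZ.relations := by
    intro k sP Mc tloF thiF hMc htlo hthi hdP' hsubP hiP' ht0 hsgn
    refine piece_good L e p₃ ℓ₁ ℓ₂ u M₀ ylo yhi sP Mc hMc tloF thiF htlo hthi (fun z => ?_) (fun z hz => ?_)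
      (hbd₁.subset hsubP) hu ht0 hsgn ⟨η, hη0, hη'⟩ hfloor
    · rw [hdP', hsec]; tauto
    · rw [hiP']; exact hint₁ (hsubP hz)
  -- membership in `s₁.domain`
  have hmem₁ : ∀ z, z ∈ s₁.domain ↔ (∀ j, 0 < affF B 1 (M j) z) ∧ affF B 1 0 z < z (Fin.natAdd (B + 1) 0) ∧
      z (Fin.natAdd (B + 1) 0) < affF B 1 wd z := fun z => by rw [hdom₁, mem_gDom_one]
  by_cases hκ0 : κF = 0
  · -- `κ' ≡ 0`: `t' + κ' = t' > 0` everywhere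
    refine key 0 s₁ (fun j => Fin.elim0 j) 0 wd (fun j => Fin.elim0 j) rfl hwd0 (fun z => ?_) Subset.rfl rfl
      (fun z _ => by rw [affF_zero'']) (Or.inl fun z t _ h1 _ => ?_)
    · rw [hmem₁]; simp
    · have h := hκv z; rw [hκ0, affF_zero''] at h; rw [affF_zero''] at h1; rw [← hsR]; linarith
  obtain ⟨sA, sB, hmA, hmB, hiA, hiB, hdA, hdB, hrelAB⟩ := cutBase s₁ M _ _ hdom₁ κF hκ0
  have hsubA : sA.domain ⊆ s₁.domain := fun z hz => ((hmA z).1 hz).1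
  have hsubB : sB.domain ⊆ s₁.domain := fun z hz => ((hmB z).1 hz).1
  -- `κ' > 0`: positive piece
  have gA : ∃ c ∈ AddSubgroup.closure (GGset B 2 1), KZ.of sA - c ∈ KZ.relations := by
    refine key 1 sA ![κF] 0 wd (fun j => by fin_cases j; simpa using hκF0) rfl hwd0 (fun z => ?_) hsubA hiA
      (fun z _ => by rw [affF_zero'']) (Or.inl fun z t hc h1 _ => ?_)
    · rw [hmA, hmem₁]; simp only [Fin.forall_fin_one, Matrix.cons_val_zero]; tauto
    · have h := hc 0; simp only [Matrix.cons_val_zero, hκv] at h; rw [affF_zero''] at h1; rw [← hsR]; linarith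
  refine good_of_split hrelAB gA ?_
  by_cases hκw : κF + wd = 0
  · -- `κ' + w ≡ 0` on `κ' < 0`: negative piece
    refine key 1 sB ![-κF] 0 wd (fun j => by fin_cases j; simpa using hneg0 κF hκF0) rfl hwd0 (fun z => ?_) hsubB hiB
      (fun z _ => by rw [affF_zero'']) (Or.inr fun z t _ _ h2 => ?_)
    · rw [hmB, hmem₁]; simp only [Fin.forall_fin_one, Matrix.cons_val_zero, affF_neg', neg_pos]; tauto
    · have h := haddv z; rw [hκw, affF_zero'', hκv] at h; rw [← hsR]; linarith
  obtain ⟨sC, sD, hmC, hmD, hiC, hiD, hdC, hdD, hrelCD⟩ := cutBase sB (Fin.snoc M (-κF)) _ _ hdB (κF + wd) hκw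
  have hsubC : sC.domain ⊆ s₁.domain := fun z hz => hsubB ((hmC z).1 hz).1
  have hsubD : sD.domain ⊆ s₁.domain := fun z hz => hsubB ((hmD z).1 hz).1
  refine good_of_split hrelCD ?_ ?_
  · -- `κ' < 0 < κ' + w`: cut the `t'`-range at `−κ'`
    have hrowsC : ∀ z : Fin (B + 1 + 1) → ℝ, (∀ j, 0 < affF B 1 ((Fin.snoc (Fin.snoc M (-κF)) (κF + wd) :
        Fin (m' + 1 + 1) → _) j) z) → affF B 1 κF z < 0 ∧ 0 < affF B 1 κF z + affF B 1 wd z := fun z hz => by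
      obtain ⟨hz', h2⟩ := rows_snoc hz
      obtain ⟨-, h1⟩ := rows_snoc hz'
      rw [affF_neg'] at h1
      rw [haddv] at h2
      exact ⟨by linarith, h2⟩
    obtain ⟨sE, sF, hdE, hdF, hiE, hiF, hsubE, hsubF, hrelEF⟩ := cutFibre sC (Fin.snoc (Fin.snoc M (-κF)) (κF + wd))
      (fun _ => Sum.inr 0) (fun _ => Sum.inr wd) hdC 0 (-κF)
      (fun z hz => by
        have h := (hrowsC z hz.1).2
        rw [affF_neg']
        show -affF B 1 κF z ≤ affF B 1 wd z
        linarith)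
      (fun z hz => by
        have h := (hrowsC z hz.1).1
        rw [affF_neg']
        show affF B 1 (0 : (Fin (B + 1) → ℚ) × ℚ) z ≤ -affF B 1 κF z
        rw [affF_zero'']
        linarith)
    rw [update_fin_one] at hdE hdF
    have hmemC : ∀ z, (∀ j, 0 < affF B 1 ((Fin.snoc (Fin.snoc M (-κF)) (κF + wd) : Fin (m' + 1 + 1) → _) j) z) ↔
        (∀ j, 0 < affF B 1 (M j) z) ∧ ∀ j : Fin 2, 0 < affF B 1 (![-κF, κF + wd] j) z := fun z => by
      simp only [Fin.forall_fin_two, Matrix.cons_val_zero, Matrix.cons_val_one]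
      simp only [Fin.forall_fin_succ', Fin.snoc_castSucc, Fin.snoc_last, and_assoc]
    refine good_of_split hrelEF ?_ ?_
    · -- `0 < t' < −κ'`: negative piece
      refine key 2 sE ![-κF, κF + wd] 0 (-κF) (fun j => by fin_cases j <;> simp [hκF0, hwd0]) rfl (hneg0 κF hκF0)
        (fun z => ?_) (fun z hz => hsubC (hsubE hz)) (by rw [hiE, hiC, hiB]) (fun z _ => by rw [affF_zero''])
        (Or.inr fun z t _ _ h2 => ?_)
      · rw [hdE, mem_gDom_one, hmemC]
      · rw [affF_neg', hκv] at h2; rw [← hsR]; linarith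
    · -- `−κ' < t' < w`: positive piece
      refine key 2 sF ![-κF, κF + wd] (-κF) wd (fun j => by fin_cases j <;> simp [hκF0, hwd0]) (hneg0 κF hκF0) hwd0
        (fun z => ?_) (fun z hz => hsubC (hsubF hz)) (by rw [hiF, hiC, hiB])
        (fun z hc => by have h := hc 0; simp only [Matrix.cons_val_zero] at h; exact h.le)
        (Or.inl fun z t _ h1 _ => ?_)
      · rw [hdF, mem_gDom_one, hmemC]
      · rw [affF_neg', hκv] at h1; rw [← hsR]; linarith
  · -- `κ' + w < 0`: negative piece
    refine key 2 sD ![-κF, -(κF + wd)] 0 wd (fun j => by fin_cases j <;> simp [hκF0, hwd0]) rfl hwd0 (fun z => ?_)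
      hsubD (by rw [hiD, hiB]) (fun z _ => by rw [affF_zero'']) (Or.inr fun z t hc _ h2 => ?_)
    · rw [hmD, hmB, hmem₁]
      simp only [Fin.forall_fin_two, Matrix.cons_val_zero, Matrix.cons_val_one, affF_neg', neg_pos]
      tauto
    · have h := hc 1
      simp only [Matrix.cons_val_one, Matrix.cons_val_zero, affF_neg', neg_pos, haddv, hκv] at h
      rw [← hsR]; linarith

end Thin

end RebasePos

/-- **Registered part of `stub_rebaseSimplePosOne`, residual hypothesis `Hpar` (line
`janus-bands`, v6.2): THIN parallel bands, sub-case (B1), by UNFOLD–EXCHANGE.** The data of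
`Hpar` (one lettered fibre over a base of dimension `B + 1`, letter `0`, affine bounds `0 < u < v`
parallel in `y` with common slope `u_y ≠ 0`, base pole `1/(y − ℓ₂(x'))` of order one), PLUS:
the base cell is a product `{x'-rows M₀} × (ylo(x'), yhi(x'))` (`hsec`), its `y`-range is
non-pinching (`hη`), and the pole `ℓ₂` lies below the `y`-range if `u_y > 0`, above it if
`u_y < 0` (`hsign`, the side condition (B1): `y` is never between `ℓ₂` and the sheared letter).
THEN `[s]` is congruent modulo `KZ.relations` to the subgroup generated by the literal class
`GG B 2 1` (`RebasePos.good_parThin`: shear, sign cuts, unfolding of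
`1/((y − ℓ₂)(y − τ))` in a new variable `σ`, integration of `y`, split, two pull-backs; rules
1a, 1b, 2, 3, every intermediate representation absolutely convergent). -/
theorem rebaseSimplePos_par_thin_exchange (B m m' m₀ : ℕ) (s : KZ.IntegralRep (B + 1 + 1)) (M : Fin m' → (Fin (B + 1) → ℚ) × ℚ) (M₀ : Fin m₀ → (Fin B → ℚ) × ℚ) (ylo yhi : (Fin B → ℚ) × ℚ) (L : Fin m → (Fin B → ℚ) × ℚ) (e : Fin m → ℕ) (p : MvPolynomial (Fin B) ℚ) (ℓ₁ ℓ₂ : (Fin B → ℚ) × ℚ) (u v : (Fin (B + 1) → ℚ) × ℚ) (hbd : Bornology.IsBounded s.domain) (hdom : s.domain = SeparatePos.gDom B 1 m' M (fun _ => Sum.inr u) (fun _ => Sum.inr v)) (hint : Set.EqOn s.integrand (RebasePos.glit B 1 p L e ℓ₁ ℓ₂ 0 1 (fun _ => some 0)) s.domain) (hu : u.1 (Fin.last B) ≠ 0) (hpar : u.1 (Fin.last B) = v.1 (Fin.last B)) (hcell : ∀ z : Fin (B + 1 + 1) → ℝ, (∀ j, 0 < SeparatePos.affF B 1 (M j)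 z) → 0 < SeparatePos.affF B 1 u z ∧ SeparatePos.affF B 1 u z < SeparatePos.affF B 1 v z) (hsec : ∀ z : Fin (B + 1 + 1) → ℝ, (∀ j, 0 < SeparatePos.affF B 1 (M j) z) ↔ ((∀ j, 0 < SeparatePos.affB B 1 (M₀ j) z) ∧ SeparatePos.affB B 1 ylo z < z (Fin.castAdd 1 (Fin.last B)) ∧ z (Fin.castAdd 1 (Fin.last B)) < SeparatePos.affB B 1 yhi z)) (hη : ∃ η : ℝ, 0 < η ∧ ∀ z : Fin (B + 1 + 1) → ℝ, (∀ j, 0 < SeparatePos.affB B 1 (M₀ j) z) → η ≤ SeparatePos.affB B 1 yhi z - SeparatePos.affB B 1 ylo z) (hsign : ∀ z : Fin (B + 1 + 1) → ℝ, (∀ j, 0 < SeparatePos.affB B 1 (M₀ j) z) → (0 < u.1 (Fin.last B) → SeparatePos.affB B 1 ℓ₂ z ≤ SeparatePos.affB B 1 ylo z) ∧ (u.1 (Fin.last B) < 0 → SeparatePos.affB B 1 yhi z ≤ SeparatePos.affB B 1 ℓ₂ z)) : ∃ c ∈ AddSubgroup.closure (SeparatePos.GGset B 2 1), KZ.of s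 - c ∈ KZ.relations :=
  RebasePos.good_parThin L e ℓ₁ ℓ₂ s M M₀ ylo yhi p u v hbd hdom hint hu hpar hcell hsec hη hsign

end Summit.KontsevichZagierPeriods.ArrangementNormalForm.JanusBands
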